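import Literature.AlgebraicGeometry.GroupSchemes.BirationalGroupLawGenericSection
import Literature.AlgebraicGeometry.Morphisms.GraphClosure
import HarnessLib

/-!
# The graph closure of a strict birational group law: the projection `pr₁₃`
# (Artin, *Néron models*, Lemma 2.3: «the proofs for the other projections are similar»)

Topic `Literature/AlgebraicGeometry/GroupSchemes`, namespace `Literature.AlgebraicGeometry.GroupSchemes`.
KERNEL ONLY: theorems; no definition, no named fact, no instance, no `sorry`.  Cell `hodgecm-mathlib`, road W,
key lemma W1b = [Artin1986NeronModels] Lemma 2.3, projection `pr₁₃` («`a⁻¹c = (xa)⁻¹(xc)`»), in the LEFT-DIVISION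
presentation: the open immersion `Φ = (pr₁, mul)` identifies `dom` with its image `D = {(a, ab)}`, on which the
left division `ldiv : (a, c) ↦ a⁻¹c` (`= pr₂ ∘ Φ⁻¹`) is a morphism; the graph of `ldiv` is the graph of `mul` with
the last two coordinates exchanged, so `pr₁₃` on the closure of the graph of `mul` is `pr₁₂` on the closure of the
graph of `ldiv`, and the latter is treated exactly as in `BirationalGroupLawGraphClosure`: for `z = (a, c, b)`
choose a section `x` with `xa`, `xc`, `(xa)b` defined (★ `exists_section_translates_defined`); the chart is
`(a′, c′) ↦ ldiv (xa′, xc′)`, defined near `(a, c)` because `Φ(xa, b) = (xa, xc)` persists from the graph to its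
closure, and equal to `ldiv` where both are defined by associativity.  The presentation `(D, ldiv, ψ : dom ≅ D)`
is ABSTRACT (`hψ₁ : ψ ≫ ι_D = Φ`, `hψ₂ : ψ ≫ ldiv = pr₂ ∘ ι`); instantiate with `Φ.opensRange`, `Φ.isoOpensRange`.

## References
* [Artin1986NeronModels] M. Artin, *Néron models*, in *Arithmetic Geometry*, Springer 1986, §2, Lemma 2.3.
* [EdixhovenRomagny] B. Edixhoven, M. Romagny, *Group schemes out of birational group laws*, Thm. 3.18.
-/

set_option autoImplicit false

noncomputable section

open CategoryTheory CategoryTheory.Limits AlgebraicGeometry TopologicalSpace Topology MonoidalCategory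
  CartesianMonoidalCategory

namespace Literature.AlgebraicGeometry.GroupSchemes

universe u

variable {S : Scheme.{u}} {𝒳 : Over S}

namespace BirationalGroupLaw

variable (L : BirationalGroupLaw 𝒳) [S.IsSeparated] [IsSeparated 𝒳.hom] [UniversallyOpen 𝒳.hom]
  [GeometricallyIrreducible 𝒳.hom] [IrreducibleSpace 𝒳.left] [IsReduced ↑(𝒳 ⊗ 𝒳).left]
  (D : (𝒳 ⊗ 𝒳).left.Opens) (ldiv : (D : Scheme.{u}) ⟶ 𝒳.left) (hw : D.ι ≫ (𝒳 ⊗ 𝒳).hom = ldiv ≫ 𝒳.hom)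
  (ψ : (L.dom : Scheme.{u}) ⟶ (D : Scheme.{u})) [IsIso ψ] (hψ₁ : ψ ≫ D.ι = L.shearLeft.left)
  (hψ₂ : ψ ≫ ldiv = L.dom.ι ≫ (snd 𝒳 𝒳).left) [QuasiCompact (pullback.lift D.ι ldiv hw)]

include hψ₁ in
omit [S.IsSeparated] [IsSeparated 𝒳.hom] [UniversallyOpen 𝒳.hom] [GeometricallyIrreducible 𝒳.hom]
  [IrreducibleSpace 𝒳.left] [IsReduced ↑(𝒳 ⊗ 𝒳).left] [QuasiCompact (pullback.lift D.ι ldiv hw)] in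
/-- The domain `D` of the left division (the image of the shear `Φ`) is dense.
[cite: EdixhovenRomagny, Def. 3.4 (1)] -/
theorem dense_leftDivDom : Dense (D : Set ↑(𝒳 ⊗ 𝒳).left) := by
  have hψs : Function.Surjective ψ.base := ψ.homeomorph.surjective
  have h1 : Set.range (ψ ≫ D.ι).base = (D : Set ↑(𝒳 ⊗ 𝒳).left) := by
    rw [← Scheme.Opens.range_ι D]
    have : ⇑(ψ ≫ D.ι).base = ⇑D.ι.base ∘ ⇑ψ.base := funext fun y => Scheme.Hom.comp_apply _ _ _
    rw [this, hψs.range_comp]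
  rw [← h1, hψ₁]
  exact L.dense_shearLeft.dense

include ψ hψ₁ hψ₂

/-- **Artin's chart for `pr₁₃`** ([Artin1986NeronModels] §2, proof of Lemma 2.3: «`a⁻¹c = (xa)⁻¹(xc)`»): for
`L` strict (standing hypotheses), the left division `(D, ldiv)` presented by `ψ : dom ≅ D`, sections dense in every
fibre and a point `z = (a, c, b)` of the scheme-theoretic image of the graph morphism `(ι_D, ldiv)`, there are an
open `V ∋ (a, c)` and `v : V → 𝒳` agreeing with `ldiv` on `V ∩ D` (`(a′, c′) ↦ ldiv (xa′, xc′)` for a section `x`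
with `xa`, `xc`, `(xa)b` defined). [cite: Artin1986NeronModels, Lemma 2.3 and its proof (p. 222)]
[cite: EdixhovenRomagny, Thm. 3.18] -/
theorem exists_chart_graphClosure_leftDiv (hL : L.IsStrict) (hsec : ∀ (x : 𝒳.left) (Ω : 𝒳.left.Opens), x ∈ Ω →
      ∃ a : S ⟶ 𝒳.left, a ≫ 𝒳.hom = 𝟙 S ∧ ∃ s : S, a.base s ∈ Ω ∧ 𝒳.hom.base (a.base s) = 𝒳.hom.base x)
    (z : ↥((pullback.lift D.ι ldiv hw).image)) :
    ∃ (V : (𝒳 ⊗ 𝒳).left.Opens) (v : (V : Scheme.{u}) ⟶ 𝒳.left), ((pullback.lift D.ι ldiv hw).imageι ≫ pullback.fst (𝒳 ⊗ 𝒳).hom 𝒳.hom).base z ∈ V ∧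
      (𝒳 ⊗ 𝒳).left.homOfLE (inf_le_left : V ⊓ D ≤ V) ≫ v = (𝒳 ⊗ 𝒳).left.homOfLE (inf_le_right : V ⊓ D ≤ D) ≫ ldiv := by
  haveI : 𝒳.left.IsSeparated := by rw [Scheme.isSeparated_iff, ← terminal.comp_from 𝒳.hom]; infer_instance
  haveI hPirr : IrreducibleSpace ↑(𝒳 ⊗ 𝒳).left := by change IrreducibleSpace ↑(pullback 𝒳.hom 𝒳.hom); infer_instance
  haveI : (𝒳 ⊗ 𝒳).left.IsSeparated := by
    change (pullback 𝒳.hom 𝒳.hom).IsSeparated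
    rw [Scheme.isSeparated_iff, ← terminal.comp_from (pullback.fst 𝒳.hom 𝒳.hom ≫ 𝒳.hom)]; infer_instance
  let γ : (D : Scheme.{u}) ⟶ pullback (𝒳 ⊗ 𝒳).hom 𝒳.hom := pullback.lift D.ι ldiv hw
  have hγ1 : γ ≫ pullback.fst _ _ = D.ι := pullback.lift_fst _ _ _
  have hγ2 : γ ≫ pullback.snd _ _ = ldiv := pullback.lift_snd _ _ _
  let Φ' : (L.dom : Scheme.{u}) ⟶ (𝒳 ⊗ 𝒳).left := L.shearLeft.left
  have hψ₁' : ψ ≫ D.ι = Φ' := hψ₁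
  have hΦ1 : Φ' ≫ (fst 𝒳 𝒳).left = L.dom.ι ≫ (fst 𝒳 𝒳).left :=
    congrArg CommaMorphism.left (LawData.shearLeft_fst 𝒳 L.dom L.mul L.mul_comp)
  have hΦ2 : Φ' ≫ (snd 𝒳 𝒳).left = L.mul :=
    congrArg CommaMorphism.left (LawData.shearLeft_snd 𝒳 L.dom L.mul L.mul_comp)
  have hfstS : (fst 𝒳 𝒳).left ≫ 𝒳.hom = (𝒳 ⊗ 𝒳).hom := Over.w (fst 𝒳 𝒳)
  have hsndS : (snd 𝒳 𝒳).left ≫ 𝒳.hom = (𝒳 ⊗ 𝒳).hom := Over.w (snd 𝒳 𝒳)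
  have hext : ∀ {T : Scheme.{u}} (f g : T ⟶ (𝒳 ⊗ 𝒳).left), f ≫ (fst 𝒳 𝒳).left = g ≫ (fst 𝒳 𝒳).left →
      f ≫ (snd 𝒳 𝒳).left = g ≫ (snd 𝒳 𝒳).left → f = g := fun f g h1 h2 => pullback.hom_ext h1 h2
  have hwα : pullback.fst 𝒳.hom (𝒳 ⊗ 𝒳).hom ≫ 𝒳.hom = (pullback.snd 𝒳.hom (𝒳 ⊗ 𝒳).hom ≫ (fst 𝒳 𝒳).left) ≫ 𝒳.hom := by
    rw [Category.assoc, hfstS, pullback.condition]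
  let α : pullback 𝒳.hom (𝒳 ⊗ 𝒳).hom ⟶ (𝒳 ⊗ 𝒳).left :=
    pullback.lift (pullback.fst 𝒳.hom (𝒳 ⊗ 𝒳).hom) (pullback.snd 𝒳.hom (𝒳 ⊗ 𝒳).hom ≫ (fst 𝒳 𝒳).left) hwα
  have hα₁ : α ≫ (fst 𝒳 𝒳).left = pullback.fst 𝒳.hom (𝒳 ⊗ 𝒳).hom := pullback.lift_fst _ _ _
  have hα₂ : α ≫ (snd 𝒳 𝒳).left = pullback.snd 𝒳.hom (𝒳 ⊗ 𝒳).hom ≫ (fst 𝒳 𝒳).left :=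
    pullback.lift_snd _ _ _
  have hresα : (α ∣_ L.dom) ≫ L.dom.ι = (α ⁻¹ᵁ L.dom).ι ≫ α := morphismRestrict_ι _ _
  have hαS : α ≫ (𝒳 ⊗ 𝒳).hom = pullback.fst 𝒳.hom (𝒳 ⊗ 𝒳).hom ≫ 𝒳.hom := by
    rw [← hα₁, Category.assoc, hfstS]
  have hwΘ : ((α ∣_ L.dom) ≫ L.mul) ≫ 𝒳.hom = ((α ⁻¹ᵁ L.dom).ι ≫ pullback.snd 𝒳.hom (𝒳 ⊗ 𝒳).hom ≫ (snd 𝒳 𝒳).left) ≫ 𝒳.hom := by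
    rw [Category.assoc, L.mul_comp, reassoc_of% hresα, hαS, pullback.condition, Category.assoc, Category.assoc, hsndS]
  let Θ : ((α ⁻¹ᵁ L.dom : (pullback 𝒳.hom (𝒳 ⊗ 𝒳).hom).Opens) : Scheme.{u}) ⟶ (𝒳 ⊗ 𝒳).left :=
    pullback.lift ((α ∣_ L.dom) ≫ L.mul) ((α ⁻¹ᵁ L.dom).ι ≫ pullback.snd 𝒳.hom (𝒳 ⊗ 𝒳).hom ≫ (snd 𝒳 𝒳).left) hwΘ
  have hΘ₁ : Θ ≫ (fst 𝒳 𝒳).left = (α ∣_ L.dom) ≫ L.mul := pullback.lift_fst _ _ _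
  have hΘ₂ : Θ ≫ (snd 𝒳 𝒳).left = (α ⁻¹ᵁ L.dom).ι ≫ pullback.snd 𝒳.hom (𝒳 ⊗ 𝒳).hom ≫ (snd 𝒳 𝒳).left :=
    pullback.lift_snd _ _ _
  have hwπ : (pullback.fst (𝒳 ⊗ 𝒳).hom 𝒳.hom ≫ (fst 𝒳 𝒳).left) ≫ 𝒳.hom = pullback.snd (𝒳 ⊗ 𝒳).hom 𝒳.hom ≫ 𝒳.hom := by
    rw [Category.assoc, hfstS, pullback.condition]
  let πP : pullback (𝒳 ⊗ 𝒳).hom 𝒳.hom ⟶ (𝒳 ⊗ 𝒳).left :=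
    pullback.lift (pullback.fst (𝒳 ⊗ 𝒳).hom 𝒳.hom ≫ (fst 𝒳 𝒳).left) (pullback.snd (𝒳 ⊗ 𝒳).hom 𝒳.hom) hwπ
  have hπ1 : πP ≫ (fst 𝒳 𝒳).left = pullback.fst _ _ ≫ (fst 𝒳 𝒳).left := pullback.lift_fst _ _ _
  have hπ2 : πP ≫ (snd 𝒳 𝒳).left = pullback.snd _ _ := pullback.lift_snd _ _ _
  have hpa : (fst 𝒳 𝒳).left.base ((γ.imageι ≫ πP).base z) = (fst 𝒳 𝒳).left.base ((γ.imageι ≫ pullback.fst _ _).base z) := by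
    change (γ.imageι ≫ πP ≫ (fst 𝒳 𝒳).left).base z = (γ.imageι ≫ pullback.fst _ _ ≫ (fst 𝒳 𝒳).left).base z
    rw [hπ1]
  have hπS : πP ≫ (𝒳 ⊗ 𝒳).hom = pullback.snd (𝒳 ⊗ 𝒳).hom 𝒳.hom ≫ 𝒳.hom := by
    rw [← hπ2, Category.assoc, hsndS]
  have hc₀ : 𝒳.hom.base ((snd 𝒳 𝒳).left.base ((γ.imageι ≫ pullback.fst _ _).base z)) = (𝒳 ⊗ 𝒳).hom.base ((γ.imageι ≫ πP).base z) := by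
    change (γ.imageι ≫ pullback.fst _ _ ≫ (snd 𝒳 𝒳).left ≫ 𝒳.hom).base z = (γ.imageι ≫ πP ≫ (𝒳 ⊗ 𝒳).hom).base z
    rw [hsndS, hπS, pullback.condition]
  -- STEP A: the section `x` with `xa`, `xc`, `(xa)b` defined
  obtain ⟨x, hx, hxa, hxc, hxab⟩ := L.exists_section_translates_defined hL hsec α hα₁ hα₂ Θ hΘ₁ hΘ₂
    ((γ.imageι ≫ πP).base z) ((snd 𝒳 𝒳).left.base ((γ.imageι ≫ pullback.fst _ _).base z)) hc₀
  rw [hpa] at hxa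
  -- STEP B: the slice `σ`, `A = σ⁻¹ dom`, `lam = mul ∘ σ|_A`, `V₁ = pr₁⁻¹ A`, `m₁ = (lam × id)`; chart `O₁, n₁, O₂`
  let σ : 𝒳.left ⟶ (𝒳 ⊗ 𝒳).left :=
    pullback.lift (𝒳.hom ≫ x) (𝟙 𝒳.left) (by rw [Category.assoc, hx, Category.comp_id, Category.id_comp])
  have hσ1 : σ ≫ (fst 𝒳 𝒳).left = 𝒳.hom ≫ x := pullback.lift_fst _ _ _
  have hσ2 : σ ≫ (snd 𝒳 𝒳).left = 𝟙 _ := pullback.lift_snd _ _ _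
  have hσS : σ ≫ (𝒳 ⊗ 𝒳).hom = 𝒳.hom := by rw [← hsndS, reassoc_of% hσ2]
  let A : 𝒳.left.Opens := σ ⁻¹ᵁ L.dom
  have hrA : Set.range (A.ι ≫ σ).base ⊆ Set.range L.dom.ι.base := by
    rintro _ ⟨a, rfl⟩
    rw [Scheme.Opens.range_ι]
    change A.ι.base a ∈ A
    rw [← SetLike.mem_coe, ← Scheme.Opens.range_ι]; exact ⟨a, rfl⟩
  let e : (A : Scheme.{u}) ⟶ (L.dom : Scheme.{u}) := IsOpenImmersion.lift L.dom.ι (A.ι ≫ σ) hrA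
  have he : e ≫ L.dom.ι = A.ι ≫ σ := IsOpenImmersion.lift_fac _ _ _
  let lam : (A : Scheme.{u}) ⟶ 𝒳.left := e ≫ L.mul
  have hlamS : lam ≫ 𝒳.hom = A.ι ≫ 𝒳.hom := by
    change (e ≫ L.mul) ≫ 𝒳.hom = _
    rw [Category.assoc, L.mul_comp, reassoc_of% he, hσS]
  let V₁ : (𝒳 ⊗ 𝒳).left.Opens := (fst 𝒳 𝒳).left ⁻¹ᵁ A
  have hres₁ : ((fst 𝒳 𝒳).left ∣_ A) ≫ A.ι = V₁.ι ≫ (fst 𝒳 𝒳).left := morphismRestrict_ι _ _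
  have hw₁ : (((fst 𝒳 𝒳).left ∣_ A) ≫ lam) ≫ 𝒳.hom = (V₁.ι ≫ (snd 𝒳 𝒳).left) ≫ 𝒳.hom := by
    rw [Category.assoc, hlamS, reassoc_of% hres₁, hfstS, Category.assoc, hsndS]
  let m₁ : (V₁ : Scheme.{u}) ⟶ (𝒳 ⊗ 𝒳).left :=
    pullback.lift (((fst 𝒳 𝒳).left ∣_ A) ≫ lam) (V₁.ι ≫ (snd 𝒳 𝒳).left) hw₁
  have hm₁1 : m₁ ≫ (fst 𝒳 𝒳).left = ((fst 𝒳 𝒳).left ∣_ A) ≫ lam := pullback.lift_fst _ _ _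
  have hm₁2 : m₁ ≫ (snd 𝒳 𝒳).left = V₁.ι ≫ (snd 𝒳 𝒳).left := pullback.lift_snd _ _ _
  let V₂ : (V₁ : Scheme.{u}).Opens := m₁ ⁻¹ᵁ L.dom
  have hres₂ : (m₁ ∣_ L.dom) ≫ L.dom.ι = V₂.ι ≫ m₁ := morphismRestrict_ι _ _
  let O₁ : (𝒳 ⊗ 𝒳).left.Opens := ((fst 𝒳 𝒳).left ⁻¹ᵁ A) ⊓ ((snd 𝒳 𝒳).left ⁻¹ᵁ A)
  obtain ⟨πa, hπa⟩ : ∃ πa : (O₁ : Scheme.{u}) ⟶ (A : Scheme.{u}), πa ≫ A.ι = O₁.ι ≫ (fst 𝒳 𝒳).left :=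
    ⟨(𝒳 ⊗ 𝒳).left.homOfLE (inf_le_left : O₁ ≤ (fst 𝒳 𝒳).left ⁻¹ᵁ A) ≫ ((fst 𝒳 𝒳).left ∣_ A), by
      rw [Category.assoc, morphismRestrict_ι, Scheme.homOfLE_ι_assoc]⟩
  obtain ⟨πc, hπc⟩ : ∃ πc : (O₁ : Scheme.{u}) ⟶ (A : Scheme.{u}), πc ≫ A.ι = O₁.ι ≫ (snd 𝒳 𝒳).left :=
    ⟨(𝒳 ⊗ 𝒳).left.homOfLE (inf_le_right : O₁ ≤ (snd 𝒳 𝒳).left ⁻¹ᵁ A) ≫ ((snd 𝒳 𝒳).left ∣_ A), by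
      rw [Category.assoc, morphismRestrict_ι, Scheme.homOfLE_ι_assoc]⟩
  have hwn : (πa ≫ lam) ≫ 𝒳.hom = (πc ≫ lam) ≫ 𝒳.hom := by
    rw [Category.assoc, hlamS, reassoc_of% hπa, hfstS, Category.assoc, hlamS, reassoc_of% hπc, hsndS]
  let n₁ : (O₁ : Scheme.{u}) ⟶ (𝒳 ⊗ 𝒳).left := pullback.lift (πa ≫ lam) (πc ≫ lam) hwn
  have hn1 : n₁ ≫ (fst 𝒳 𝒳).left = πa ≫ lam := pullback.lift_fst _ _ _
  have hn2 : n₁ ≫ (snd 𝒳 𝒳).left = πc ≫ lam := pullback.lift_snd _ _ _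
  let O₂ : (O₁ : Scheme.{u}).Opens := n₁ ⁻¹ᵁ D
  have hresn : (n₁ ∣_ D) ≫ D.ι = O₂.ι ≫ n₁ := morphismRestrict_ι _ _
  let v' : (O₂ : Scheme.{u}) ⟶ 𝒳.left := (n₁ ∣_ D) ≫ ldiv
  -- STEP C: associativity `x(ab) = (xa)b` on `T`-valued points: the `dom`-point `(xa, b)` maps under `Φ` to `(xa, xc)`
  have keyA : ∀ {R : Scheme.{u}} (o₁ : R ⟶ (O₁ : Scheme.{u})) (rd d₃ : R ⟶ (L.dom : Scheme.{u})),
      o₁ ≫ O₁.ι = rd ≫ Φ' → d₃ ≫ L.dom.ι ≫ (fst 𝒳 𝒳).left = (o₁ ≫ πa) ≫ lam → d₃ ≫ L.dom.ι ≫ (snd 𝒳 𝒳).left = rd ≫ L.dom.ι ≫ (snd 𝒳 𝒳).left → d₃ ≫ Φ' = o₁ ≫ n₁ := by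
    intro R o₁ rd d₃ h₁ h₂ h₃
    have hra : (o₁ ≫ πa) ≫ A.ι = rd ≫ L.dom.ι ≫ (fst 𝒳 𝒳).left := by
      rw [Category.assoc, hπa, reassoc_of% h₁, hΦ1]
    have hrc : (o₁ ≫ πc) ≫ A.ι = rd ≫ L.mul := by
      rw [Category.assoc, hπc, reassoc_of% h₁, hΦ2]
    have hmul : d₃ ≫ L.mul = (o₁ ≫ πc) ≫ lam := by
      refine L.assoc (a := rd ≫ L.dom.ι ≫ (𝒳 ⊗ 𝒳).hom ≫ x) (b := (o₁ ≫ πa) ≫ A.ι)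
        (c := rd ≫ L.dom.ι ≫ (snd 𝒳 𝒳).left) (ab := (o₁ ≫ πa) ≫ lam) (bc := rd ≫ L.mul)
        (q₁ := (o₁ ≫ πa) ≫ e) (q₂ := rd) (q₃ := d₃) (q₄ := (o₁ ≫ πc) ≫ e)
        ⟨?_, ?_, ?_⟩ ⟨hra.symm, rfl, rfl⟩ ⟨h₂, h₃, rfl⟩ ⟨?_, ?_, ?_⟩
      · rw [Category.assoc, reassoc_of% he, hσ1, ← Category.assoc, hra, Category.assoc, Category.assoc, reassoc_of% hfstS]
      · rw [Category.assoc, reassoc_of% he, hσ2, Category.comp_id]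
      · rw [Category.assoc]
      · rw [Category.assoc, reassoc_of% he, hσ1, ← Category.assoc, hrc, Category.assoc, reassoc_of% L.mul_comp]
      · rw [Category.assoc, reassoc_of% he, hσ2, Category.comp_id, hrc]
      · rw [Category.assoc]
    refine hext _ _ ?_ ?_
    · rw [Category.assoc, hΦ1, h₂, Category.assoc, Category.assoc, hn1]
    · rw [Category.assoc, hΦ2, hmul, Category.assoc, Category.assoc, hn2]
  -- STEP D: `p₀ = q₁ z` lies in the chart: (1) `p₀ ∈ O₁`, `p = πP z ∈ V₁`; (2) `p₁ ∈ V₂`; (3) `o₁ ∈ O₂`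
  have hp₀O₁ : (γ.imageι ≫ pullback.fst _ _).base z ∈ O₁ := Opens.mem_inf.mpr ⟨hxa, hxc⟩
  obtain ⟨o₁, ho₁⟩ : (γ.imageι ≫ pullback.fst _ _).base z ∈ Set.range O₁.ι.base := by
    rw [Scheme.Opens.range_ι]; exact hp₀O₁
  have hp₀V₁ : (γ.imageι ≫ πP).base z ∈ V₁ := by change _ ∈ A; rw [hpa]; exact hxa
  obtain ⟨p₁, hp₁⟩ : (γ.imageι ≫ πP).base z ∈ Set.range V₁.ι.base := by
    rw [Scheme.Opens.range_ι]; exact hp₀V₁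
  have hwκ : (V₁.ι ≫ (𝒳 ⊗ 𝒳).hom ≫ x) ≫ 𝒳.hom = V₁.ι ≫ (𝒳 ⊗ 𝒳).hom := by
    rw [Category.assoc, Category.assoc, hx, Category.comp_id]
  let κ : (V₁ : Scheme.{u}) ⟶ pullback 𝒳.hom (𝒳 ⊗ 𝒳).hom := pullback.lift (V₁.ι ≫ (𝒳 ⊗ 𝒳).hom ≫ x) V₁.ι hwκ
  have hκ1 : κ ≫ pullback.fst _ _ = V₁.ι ≫ (𝒳 ⊗ 𝒳).hom ≫ x := pullback.lift_fst _ _ _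
  have hκ2 : κ ≫ pullback.snd _ _ = V₁.ι := pullback.lift_snd _ _ _
  have hκα : κ ≫ α = ((fst 𝒳 𝒳).left ∣_ A) ≫ e ≫ L.dom.ι := by
    refine hext _ _ ?_ ?_
    · rw [Category.assoc, hα₁, hκ1, Category.assoc, Category.assoc, reassoc_of% he, hσ1, reassoc_of% hres₁, reassoc_of% hfstS]
    · rw [Category.assoc, hα₂, reassoc_of% hκ2, Category.assoc, Category.assoc, reassoc_of% he, hσ2, Category.comp_id, hres₁]
  have hrκ : Set.range κ.base ⊆ Set.range (α ⁻¹ᵁ L.dom).ι.base := by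
    rintro _ ⟨p, rfl⟩
    rw [Scheme.Opens.range_ι]
    change (κ ≫ α).base p ∈ L.dom
    rw [hκα, ← SetLike.mem_coe, ← Scheme.Opens.range_ι]
    exact ⟨_, rfl⟩
  let κ' : (V₁ : Scheme.{u}) ⟶ ((α ⁻¹ᵁ L.dom : (pullback 𝒳.hom (𝒳 ⊗ 𝒳).hom).Opens) : Scheme.{u}) :=
    IsOpenImmersion.lift (α ⁻¹ᵁ L.dom).ι κ hrκ
  have hκ' : κ' ≫ (α ⁻¹ᵁ L.dom).ι = κ := IsOpenImmersion.lift_fac _ _ _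
  have hκ'res : κ' ≫ (α ∣_ L.dom) = ((fst 𝒳 𝒳).left ∣_ A) ≫ e := by
    rw [← cancel_mono L.dom.ι, Category.assoc, hresα, reassoc_of% hκ', hκα, Category.assoc]
  have hκ'Θ : κ' ≫ Θ = m₁ := by
    refine hext _ _ ?_ ?_
    · rw [Category.assoc, hΘ₁, reassoc_of% hκ'res, hm₁1]
    · rw [Category.assoc, hΘ₂, reassoc_of% hκ', reassoc_of% hκ2, hm₁2]
  have hκp₁ : κ.base p₁ = (pullback.lift ((𝒳 ⊗ 𝒳).hom ≫ x) (𝟙 (𝒳 ⊗ 𝒳).left)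
      (by rw [Category.assoc, hx, Category.comp_id, Category.id_comp])).base
      ((γ.imageι ≫ πP).base z) := by
    have : κ = V₁.ι ≫ pullback.lift ((𝒳 ⊗ 𝒳).hom ≫ x) (𝟙 (𝒳 ⊗ 𝒳).left)
        (by rw [Category.assoc, hx, Category.comp_id, Category.id_comp]) := by
      apply pullback.hom_ext
      · rw [hκ1, Category.assoc, pullback.lift_fst]
      · rw [hκ2, Category.assoc, pullback.lift_snd, Category.comp_id]
    rw [this, Scheme.Hom.comp_apply, hp₁]
  obtain ⟨w', hw'Θ, hw'⟩ := hxab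
  have hκ'p₁ : κ'.base p₁ = w' := (α ⁻¹ᵁ L.dom).ι.isOpenEmbedding.injective (by
    change (κ' ≫ (α ⁻¹ᵁ L.dom).ι).base p₁ = _
    rw [hκ', hκp₁]; exact hw'.symm)
  have hp₁V₂ : p₁ ∈ V₂ := by
    change m₁.base p₁ ∈ L.dom
    rw [← hκ'Θ, Scheme.Hom.comp_apply, hκ'p₁]
    exact hw'Θ
  obtain ⟨p₂, hp₂⟩ : p₁ ∈ Set.range V₂.ι.base := by rw [Scheme.Opens.range_ι]; exact hp₁V₂
  let Γ' : (γ.image : Scheme.{u}).Opens :=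
    ((γ.imageι ≫ pullback.fst _ _) ⁻¹ᵁ O₁) ⊓ ((γ.imageι ≫ πP) ⁻¹ᵁ (V₁.ι ''ᵁ V₂))
  have hzΓ' : z ∈ Γ' := Opens.mem_inf.mpr ⟨hp₀O₁, ⟨p₁, hp₁V₂, hp₁⟩⟩
  obtain ⟨z', hz'⟩ : z ∈ Set.range Γ'.ι.base := by rw [Scheme.Opens.range_ι]; exact hzΓ'
  have hΓ'mem : ∀ y : ↥Γ', Γ'.ι.base y ∈ Γ' := fun y => by
    rw [← SetLike.mem_coe, ← Scheme.Opens.range_ι]; exact ⟨y, rfl⟩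
  have hrℓ₁ : Set.range (Γ'.ι ≫ γ.imageι ≫ pullback.fst _ _).base ⊆ Set.range O₁.ι.base := by
    rintro _ ⟨y, rfl⟩
    rw [Scheme.Opens.range_ι]
    exact (Opens.mem_inf.mp (hΓ'mem y)).1
  have hrℓ₂ : Set.range (Γ'.ι ≫ γ.imageι ≫ πP).base ⊆ Set.range (V₂.ι ≫ V₁.ι).base := by
    rintro _ ⟨y, rfl⟩
    obtain ⟨-, ⟨p, hpV₂, hp⟩⟩ := Opens.mem_inf.mp (hΓ'mem y)
    obtain ⟨p', rfl⟩ : p ∈ Set.range V₂.ι.base := by rw [Scheme.Opens.range_ι]; exact hpV₂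
    exact ⟨p', by simp only [Scheme.Hom.comp_apply] at hp ⊢; exact hp⟩
  let ℓ₁ : (Γ' : Scheme.{u}) ⟶ (O₁ : Scheme.{u}) :=
    IsOpenImmersion.lift O₁.ι (Γ'.ι ≫ γ.imageι ≫ pullback.fst _ _) hrℓ₁
  have hℓ₁ : ℓ₁ ≫ O₁.ι = Γ'.ι ≫ γ.imageι ≫ pullback.fst _ _ := IsOpenImmersion.lift_fac _ _ _
  let ℓ₂ : (Γ' : Scheme.{u}) ⟶ (V₂ : Scheme.{u}) :=
    IsOpenImmersion.lift (V₂.ι ≫ V₁.ι) (Γ'.ι ≫ γ.imageι ≫ πP) hrℓ₂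
  have hℓ₂ : ℓ₂ ≫ V₂.ι ≫ V₁.ι = Γ'.ι ≫ γ.imageι ≫ πP := IsOpenImmersion.lift_fac _ _ _
  let δ : ((γ.toImage ⁻¹ᵁ Γ' : (D : Scheme.{u}).Opens) : Scheme.{u}) ⟶ (Γ' : Scheme.{u}) := γ.toImage ∣_ Γ'
  have hδ : δ ≫ Γ'.ι = (γ.toImage ⁻¹ᵁ Γ').ι ≫ γ.toImage := morphismRestrict_ι _ _
  haveI hδdom : IsDominant δ := IsZariskiLocalAtTarget.restrict (P := @IsDominant) inferInstance Γ'
  have keyG : ∀ {R : Scheme.{u}} (rG : R ⟶ ((γ.toImage ⁻¹ᵁ Γ' : (D : Scheme.{u}).Opens) : Scheme.{u})),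
      (rG ≫ δ ≫ ℓ₂ ≫ (m₁ ∣_ L.dom)) ≫ Φ' = (rG ≫ δ ≫ ℓ₁) ≫ n₁ ∧ (rG ≫ δ ≫ ℓ₂ ≫ (m₁ ∣_ L.dom)) ≫ L.dom.ι ≫ (snd 𝒳 𝒳).left =
        (rG ≫ (γ.toImage ⁻¹ᵁ Γ').ι ≫ inv ψ) ≫ L.dom.ι ≫ (snd 𝒳 𝒳).left := by
    intro R rG
    have hGD : rG ≫ δ ≫ Γ'.ι ≫ γ.imageι = rG ≫ (γ.toImage ⁻¹ᵁ Γ').ι ≫ γ := by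
      rw [reassoc_of% hδ, Scheme.Hom.toImage_imageι]
    have h₃ : (rG ≫ δ ≫ ℓ₂ ≫ (m₁ ∣_ L.dom)) ≫ L.dom.ι ≫ (snd 𝒳 𝒳).left = (rG ≫ (γ.toImage ⁻¹ᵁ Γ').ι ≫ inv ψ) ≫ L.dom.ι ≫ (snd 𝒳 𝒳).left := by
      rw [Category.assoc, Category.assoc, Category.assoc, reassoc_of% hres₂, hm₁2, reassoc_of% hℓ₂,
        reassoc_of% hGD, hπ2, hγ2, Category.assoc, Category.assoc, ← hψ₂, IsIso.inv_hom_id_assoc]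
    refine ⟨keyA _ (rG ≫ (γ.toImage ⁻¹ᵁ Γ').ι ≫ inv ψ) _ ?_ ?_ h₃, h₃⟩
    · rw [Category.assoc, Category.assoc, hℓ₁, reassoc_of% hGD, hγ1, Category.assoc, Category.assoc, ← hψ₁', IsIso.inv_hom_id_assoc]
    · have haux : rG ≫ δ ≫ ℓ₂ ≫ V₂.ι ≫ ((fst 𝒳 𝒳).left ∣_ A) = rG ≫ δ ≫ ℓ₁ ≫ πa := by
        rw [← cancel_mono A.ι]
        simp only [Category.assoc]
        rw [hres₁, reassoc_of% hℓ₂, hπ1, hπa, reassoc_of% hℓ₁]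
      simp only [Category.assoc]
      rw [reassoc_of% hres₂, hm₁1, ← reassoc_of% haux]
  have hzE : z' ∈ Set.range (equalizer.ι (ℓ₁ ≫ n₁) (ℓ₂ ≫ (m₁ ∣_ L.dom) ≫ Φ')).base := by
    have hδeq : δ ≫ ℓ₁ ≫ n₁ = δ ≫ ℓ₂ ≫ (m₁ ∣_ L.dom) ≫ Φ' := by
      have := (keyG (𝟙 _)).1
      simp only [Category.id_comp, Category.assoc] at this
      exact this.symm
    have hsub : Set.range δ.base ⊆ Set.range (equalizer.ι (ℓ₁ ≫ n₁) (ℓ₂ ≫ (m₁ ∣_ L.dom) ≫ Φ')).base := by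
      rw [show δ = equalizer.lift δ hδeq ≫ equalizer.ι _ _ from (equalizer.lift_ι _ _).symm, Scheme.Hom.comp_base,
        TopCat.coe_comp]; exact Set.range_comp_subset_range _ _
    have hcl := closure_minimal hsub (equalizer.ι (ℓ₁ ≫ n₁) (ℓ₂ ≫ (m₁ ∣_ L.dom) ≫ Φ')).isClosedEmbedding.isClosed_range
    rw [δ.denseRange.closure_range] at hcl
    exact hcl (Set.mem_univ _)
  obtain ⟨ε, hε⟩ := hzE
  have hgz : n₁.base (ℓ₁.base z') = Φ'.base ((m₁ ∣_ L.dom).base (ℓ₂.base z')) := by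
    have := congrArg (fun φ => φ.base ε) (equalizer.condition (ℓ₁ ≫ n₁) (ℓ₂ ≫ (m₁ ∣_ L.dom) ≫ Φ'))
    simp only [Scheme.Hom.comp_apply] at this
    rwa [hε] at this
  have hℓ₁z : ℓ₁.base z' = o₁ := O₁.ι.isOpenEmbedding.injective (by
    change (ℓ₁ ≫ O₁.ι).base z' = _
    rw [hℓ₁, ho₁]
    simp only [Scheme.Hom.comp_apply]
    rw [hz'])
  have ho₁O₂ : o₁ ∈ O₂ := by
    change n₁.base o₁ ∈ D
    rw [← hℓ₁z, hgz, ← hψ₁', Scheme.Hom.comp_apply, ← SetLike.mem_coe, ← Scheme.Opens.range_ι]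
    exact ⟨_, rfl⟩
  obtain ⟨o₂, ho₂⟩ : o₁ ∈ Set.range O₂.ι.base := by rw [Scheme.Opens.range_ι]; exact ho₁O₂
  haveI : IsOpenImmersion (O₂.ι ≫ O₁.ι) := inferInstance
  refine ⟨(O₂.ι ≫ O₁.ι).opensRange, (O₂.ι ≫ O₁.ι).isoOpensRange.inv ≫ v', ?_, ?_⟩
  · refine ⟨o₂, ?_⟩
    change _ = (γ.imageι ≫ pullback.fst _ _).base z
    rw [← ho₁, ← ho₂]
    simp only [Scheme.Hom.comp_apply]
  have hGne : ((γ.toImage ⁻¹ᵁ Γ' : (D : Scheme.{u}).Opens) : Set ↥(D : Scheme.{u})).Nonempty :=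
    γ.toImage.denseRange.exists_mem_open Γ'.isOpen ⟨z, hzΓ'⟩
  have hQ'le : (O₂.ι ≫ O₁.ι).opensRange ⊓ D ⊓ (D.ι ''ᵁ (γ.toImage ⁻¹ᵁ Γ')) ≤ (O₂.ι ≫ O₁.ι).opensRange ⊓ D :=
    inf_le_left
  have hQ'dense : Dense (((O₂.ι ≫ O₁.ι).opensRange ⊓ D ⊓ (D.ι ''ᵁ (γ.toImage ⁻¹ᵁ Γ')) :
      (𝒳 ⊗ 𝒳).left.Opens) : Set ↑(𝒳 ⊗ 𝒳).left) := by
    refine (Opens.isOpen _).dense ?_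
    rw [Opens.coe_inf, Opens.coe_inf]
    obtain ⟨g, hg⟩ := hGne
    refine nonempty_preirreducible_inter ((Opens.isOpen _).inter D.isOpen) (Opens.isOpen _)
      (nonempty_preirreducible_inter (Opens.isOpen _) D.isOpen ⟨_, ⟨o₂, rfl⟩⟩ ⟨_, g.2⟩) ⟨D.ι.base g, ⟨g, hg, rfl⟩⟩
  haveI : IsDominant ((𝒳 ⊗ 𝒳).left.homOfLE hQ'le) := Opens.isDominant_homOfLE hQ'dense _
  refine ext_of_isDominant ((𝒳 ⊗ 𝒳).left.homOfLE hQ'le) ?_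
  have hrG : Set.range ((𝒳 ⊗ 𝒳).left.homOfLE hQ'le ≫ ((O₂.ι ≫ O₁.ι).opensRange ⊓ D).ι).base ⊆ Set.range ((γ.toImage ⁻¹ᵁ Γ').ι ≫ D.ι).base := by
    rintro _ ⟨q, rfl⟩
    have hq : ((𝒳 ⊗ 𝒳).left.homOfLE hQ'le ≫ ((O₂.ι ≫ O₁.ι).opensRange ⊓ D).ι).base q ∈
        (O₂.ι ≫ O₁.ι).opensRange ⊓ D ⊓ (D.ι ''ᵁ (γ.toImage ⁻¹ᵁ Γ')) := by
      rw [Scheme.homOfLE_ι, ← SetLike.mem_coe, ← Scheme.Opens.range_ι]; exact ⟨q, rfl⟩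
    obtain ⟨g, hgG, hg⟩ := (Opens.mem_inf.mp hq).2
    obtain ⟨g', rfl⟩ : g ∈ Set.range (γ.toImage ⁻¹ᵁ Γ').ι.base := by rw [Scheme.Opens.range_ι]; exact hgG
    exact ⟨g', by rw [Scheme.Hom.comp_apply]; exact hg⟩
  let rG := IsOpenImmersion.lift ((γ.toImage ⁻¹ᵁ Γ').ι ≫ D.ι)
    ((𝒳 ⊗ 𝒳).left.homOfLE hQ'le ≫ ((O₂.ι ≫ O₁.ι).opensRange ⊓ D).ι) hrG
  have hrG' : rG ≫ (γ.toImage ⁻¹ᵁ Γ').ι ≫ D.ι = (𝒳 ⊗ 𝒳).left.homOfLE hQ'le ≫ ((O₂.ι ≫ O₁.ι).opensRange ⊓ D).ι := IsOpenImmersion.lift_fac _ _ _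
  have hrGD : rG ≫ (γ.toImage ⁻¹ᵁ Γ').ι = (𝒳 ⊗ 𝒳).left.homOfLE hQ'le ≫ (𝒳 ⊗ 𝒳).left.homOfLE inf_le_right := by
    rw [← cancel_mono D.ι]
    simp only [Category.assoc, hrG', Scheme.homOfLE_ι]
  have ho : (((𝒳 ⊗ 𝒳).left.homOfLE hQ'le ≫ (𝒳 ⊗ 𝒳).left.homOfLE inf_le_left) ≫
      (O₂.ι ≫ O₁.ι).isoOpensRange.inv) ≫ O₂.ι = rG ≫ δ ≫ ℓ₁ := by
    rw [← cancel_mono O₁.ι]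
    simp only [Category.assoc]
    rw [hℓ₁, reassoc_of% hδ, Scheme.Hom.toImage_imageι_assoc, hγ1, reassoc_of% hrGD, Scheme.homOfLE_ι, Scheme.Hom.isoOpensRange_inv_comp, Scheme.homOfLE_ι]
  obtain ⟨k₁, k₂⟩ := keyG rG
  have hψo : (rG ≫ δ ≫ ℓ₂ ≫ (m₁ ∣_ L.dom)) ≫ ψ = (((𝒳 ⊗ 𝒳).left.homOfLE hQ'le ≫ (𝒳 ⊗ 𝒳).left.homOfLE inf_le_left) ≫
        (O₂.ι ≫ O₁.ι).isoOpensRange.inv) ≫ (n₁ ∣_ D) := by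
    rw [← cancel_mono D.ι, Category.assoc, hψ₁', k₁]
    simp only [Category.assoc]
    rw [← reassoc_of% ho, hresn]
  calc (𝒳 ⊗ 𝒳).left.homOfLE hQ'le ≫ (𝒳 ⊗ 𝒳).left.homOfLE inf_le_left ≫
        (O₂.ι ≫ O₁.ι).isoOpensRange.inv ≫ (n₁ ∣_ D) ≫ ldiv
      = ((((𝒳 ⊗ 𝒳).left.homOfLE hQ'le ≫ (𝒳 ⊗ 𝒳).left.homOfLE inf_le_left) ≫
          (O₂.ι ≫ O₁.ι).isoOpensRange.inv) ≫ (n₁ ∣_ D)) ≫ ldiv := by simp only [Category.assoc]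
    _ = ((rG ≫ δ ≫ ℓ₂ ≫ (m₁ ∣_ L.dom)) ≫ ψ) ≫ ldiv := by rw [hψo]
    _ = (rG ≫ (γ.toImage ⁻¹ᵁ Γ').ι ≫ inv ψ) ≫ L.dom.ι ≫ (snd 𝒳 𝒳).left := by rw [Category.assoc, hψ₂, k₂]
    _ = (𝒳 ⊗ 𝒳).left.homOfLE hQ'le ≫ (𝒳 ⊗ 𝒳).left.homOfLE inf_le_right ≫ ldiv := by
          rw [Category.assoc, Category.assoc, ← hψ₂, IsIso.inv_hom_id_assoc, reassoc_of% hrGD]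

/-- **Artin's Lemma 2.3 for `pr₁₃`** (left-division presentation; [Artin1986NeronModels] Lemma 2.3,
[EdixhovenRomagny] Thm. 3.18): for `L` strict with fibrewise-dense sections, the first projection of the
scheme-theoretic image of the graph of the left division — `pr₁₃` on the closure of the graph of `mul` — is an
OPEN IMMERSION. [cite: Artin1986NeronModels, Lemma 2.3 (p. 222)] [cite: EdixhovenRomagny, Thm. 3.18] -/
theorem isOpenImmersion_graphClosure_fst_leftDiv (hL : L.IsStrict) (hsec : ∀ (x : 𝒳.left) (Ω : 𝒳.left.Opens), x ∈ Ω →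
      ∃ a : S ⟶ 𝒳.left, a ≫ 𝒳.hom = 𝟙 S ∧ ∃ s : S, a.base s ∈ Ω ∧ 𝒳.hom.base (a.base s) = 𝒳.hom.base x) :
    IsOpenImmersion ((pullback.lift D.ι ldiv hw).imageι ≫ pullback.fst (𝒳 ⊗ 𝒳).hom 𝒳.hom) := by
  haveI : 𝒳.left.IsSeparated := by rw [Scheme.isSeparated_iff, ← terminal.comp_from 𝒳.hom]; infer_instance
  haveI : IrreducibleSpace ↑(𝒳 ⊗ 𝒳).left := by change IrreducibleSpace ↑(pullback 𝒳.hom 𝒳.hom); infer_instance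
  exact Literature.AlgebraicGeometry.Morphisms.isOpenImmersion_graphClosure_fst (𝒳 ⊗ 𝒳).hom 𝒳.hom D
    (L.dense_leftDivDom D ψ hψ₁) ldiv hw (L.exists_chart_graphClosure_leftDiv D ldiv hw ψ hψ₁ hψ₂ hL hsec)

/-- **The image of `pr₁₃` is the domain of definition of the left division** ([Artin1986NeronModels] (2.5)):
`im pr₁ = Dom(ldiv)`, the Mathlib `Scheme.RationalMap.domain` of the rational map `(a, c) ↦ a⁻¹c`.
[cite: Artin1986NeronModels, Lemma 2.3 and (2.5) (p. 222)] [cite: EdixhovenRomagny, Thm. 3.18] -/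
theorem range_graphClosure_fst_leftDiv_eq_domain (hL : L.IsStrict) (hsec : ∀ (x : 𝒳.left) (Ω : 𝒳.left.Opens), x ∈ Ω →
      ∃ a : S ⟶ 𝒳.left, a ≫ 𝒳.hom = 𝟙 S ∧ ∃ s : S, a.base s ∈ Ω ∧ 𝒳.hom.base (a.base s) = 𝒳.hom.base x) :
    Set.range ((pullback.lift D.ι ldiv hw).imageι ≫ pullback.fst (𝒳 ⊗ 𝒳).hom 𝒳.hom).base =
      ((Scheme.PartialMap.toRationalMap ⟨D, L.dense_leftDivDom D ψ hψ₁, ldiv⟩).domain : Set ↑(𝒳 ⊗ 𝒳).left) := by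
  haveI : 𝒳.left.IsSeparated := by rw [Scheme.isSeparated_iff, ← terminal.comp_from 𝒳.hom]; infer_instance
  haveI : IrreducibleSpace ↑(𝒳 ⊗ 𝒳).left := by change IrreducibleSpace ↑(pullback 𝒳.hom 𝒳.hom); infer_instance
  refine Literature.AlgebraicGeometry.Morphisms.range_graphClosure_fst (𝒳 ⊗ 𝒳).hom 𝒳.hom D
    (L.dense_leftDivDom D ψ hψ₁) ldiv hw fun z => ?_
  obtain ⟨V, v, hzV, hv⟩ := L.exists_chart_graphClosure_leftDiv D ldiv hw ψ hψ₁ hψ₂ hL hsec z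
  have hVd : Dense (V : Set ↑(𝒳 ⊗ 𝒳).left) := V.2.dense ⟨_, hzV⟩
  have heq : Scheme.PartialMap.toRationalMap ⟨V, hVd, v⟩ = Scheme.PartialMap.toRationalMap ⟨D, L.dense_leftDivDom D ψ hψ₁, ldiv⟩ :=
    Scheme.PartialMap.toRationalMap_eq_iff.mpr
      ⟨V ⊓ D, hVd.inter_of_isOpen_left (L.dense_leftDivDom D ψ hψ₁) V.2, inf_le_left, inf_le_right, by
        rw [Scheme.PartialMap.restrict_hom, Scheme.PartialMap.restrict_hom]; exact hv⟩
  exact Scheme.RationalMap.mem_domain.mpr ⟨⟨V, hVd, v⟩, hzV, heq⟩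

end BirationalGroupLaw

end Literature.AlgebraicGeometry.GroupSchemes

end
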